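import Summits.ValiantsHypothesis.ValiantsHypothesis.Theorems.LacunarySymmetroidMatrixDescartesPivotRankOneFourCoverKit
import Summits.ValiantsHypothesis.ValiantsHypothesis.Theorems.LacunarySymmetroidMatrixDescartesPivotRankOneFourCoverBounds
import Summits.ValiantsHypothesis.ValiantsHypothesis.Theorems.LacunarySymmetroidMatrixDescartesPivotRankOneFourCoverBoundsII
import Summits.ValiantsHypothesis.ValiantsHypothesis.Theorems.LacunarySymmetroidMatrixDescartesPivotRankOneFourKillSevenPrime
import Summits.ValiantsHypothesis.ValiantsHypothesis.Theorems.LacunarySymmetroidMatrixDescartesPivotRankOneFourKillSevenInner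
import Summits.ValiantsHypothesis.ValiantsHypothesis.Theorems.LacunarySymmetroidMatrixDescartesPivotRankOneFourKillSevenBottom
import Summits.ValiantsHypothesis.ValiantsHypothesis.Theorems.LacunarySymmetroidMatrixDescartesPivotRankOneReduction

/-!
# `MatrixDescartes` census — RANK-ONE `(2,4)₁` IN THE INTERLEAVING CHAMBER (B): `Z₊ ≤ 8 = 2K`, UNCONDITIONALLY
# (the covering theorem: on every configuration one of the five kernel kill-seven certificates applies)

HONEST FRAMING.  Object-search cell `pub-symmetroid`, seat `val-sym-mdr-p1` (generation 15); helper file `--supports` the crux item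
stmt-ValiantsHypothesis-18050 (`Theses.LacunarySymmetroid.MatrixDescartes`, OPEN, on HOLD) with NO closure claim.  A sub-family law
beside the crux: it settles the chamber that generations g12–g14 of this seat reduced the rank-one `(2,4)₁` question to (for the 2/2
split), nothing more.  Nothing here bears on `MatrixDescartes` in its window, on `DoorA26` / `DoorA34`, registers / credences, or
`VP ≠ VNP`.

**THEOREM (`rankOne_chamberB_posRoots_le_eight`).**  Let `F = X^e J + ∑ₖ wₖ X^{dₖ} vₖvₖᵀ` be a real symmetric `2 × 2` pencil with a
pivot `J` (ANY real symmetric `2 × 2` matrix) and four rank-one letters (`vₖ ∈ ℝ²` arbitrary, `wₖ > 0`) whose exponents lie in the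
interleaving chamber (B): `d₀ < d₁ < e < d₂ < d₃`, `d₀ + d₂ < e + d₁`, `d₁ + d₂ < 2e < d₀ + d₃ < e + d₂` — the one chamber of the
2/2 split (with its mirror (A)) where the eleven coefficients of `det F` can alternate ten times.  Then `det F` has AT MOST EIGHT
distinct positive roots.  EIGHT is the conjectured value `2K` of the `(2,4)` pivot row and is attained by rank-one letters
(`…PivotRankOneEight`).
With g13's `…PivotRankOneReduction.rankOne_posRoots_le_eight_of_not_interleaving` (`Z₊ ≤ 8` off chambers (A), (B)) only the
mirror chamber (A) (the image of (B) under `X ↦ 1/X`) now separates the whole 2/2 split `d₀ < d₁ < e < d₂ < d₃` from `Z₊ ≤ 8`;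
the 1/3 and 3/1 splits (chambers (C), (C′) of `…PivotRankOneReductionOneThree`) are untouched here.

PROOF (the covering theorem).  (0) If `det J ≥ 0` or some letter does not pair negatively with `J` (`m(J,vₖ) ≥ 0`), a pivot-type
coefficient is non-negative and `RankOneReduction.elevenNomial_le_eight_of_coeff_nonneg` gives `8`.  (1) Otherwise `J` is indefinite
and all letters are core; the quadratic form `v ↦ vᵀ adj(J) v` factors as `−2 ℓ₁(v) ℓ₂(v)` over ℝ (`exists_isotropic_frame`, the
two isotropic lines of `J`), and in the coordinates `tₖ = ℓ₂(vₖ)/ℓ₁(vₖ) > 0`, `ŵₖ = wₖ ℓ₁(vₖ)²/(−det J)` the determinant is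
`(−det J)` times the NORMAL FORM `−X^{2e} − 2∑ ŵₖtₖ X^{e+dₖ} + ∑_{k<l} ŵₖŵ_l (t_l − tₖ)² X^{dₖ+d_l}`
(`normalForm_chamberB_le_eight`).  (2) For the normal form the five weight-free kill-seven certificates of the kernel —
(S) `…KillSeven`, (S′) `…KillSevenPrime`, (P) `…KillSevenPairs` (here with `D12 ≥ 0`, `…CoverKit`), (P′) `…KillSevenInner`,
(T) `…KillSevenBottom` — read `ρ_X(exponents) · R_X(t) ≤ 1`; the chamber splits at the hyperplane `4(e − d₁) = (e − d₀) + 2(d₂ − e)`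
into two simplicial cones on which `…CoverBounds{,II}` bound the exponent constants (`ρ_P ≤ 1/16`, `ρ_P′ ≤ 1/4` on Region I;
`ρ_S ≤ 1/5000`, `ρ_S′ ≤ 3/25`, `ρ_S′ρ_T ≤ 1/16` on Region II), and `…CoverKit` shows that with these constants one of (P), (P′)
(Region I; Plücker relation of four points on a line) or one of (S), (S′), (T) (Region II; triangle equality on three points) holds
for EVERY direction configuration; the parallel loci `tₖ = t_l` are routed to (S), (P) or (P′) by hand.  WHY FIVE SUFFICE: the
weight-dependent circuit certificates of g14's located ten-cover all fail as the weights tend to zero along a gauge-invariant ray, so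
the ten-cover is equivalent to this five-cover (seat memo FIVE-COVER.md).

[folklore] Elementary; the kill engine and certificates of this lineage (`…PivotTwoDirectionsBlockLaw`, g12–g14 files).  No definitions,
no named facts.
-/

-- `Summit.ValiantsHypothesis.ValiantsHypothesis.…` repeats a component by the D-0017 layout
-- (single-conjunct summit), which the `dupNamespace` linter flags; the name is mandated.
set_option linter.dupNamespace false

open Polynomial Matrix Finset
open scoped BigOperators
open Summit.ValiantsHypothesis.ValiantsHypothesis.Theorems.LacunarySymmetroidMatrixDescartes.Pivot.TwoDirections.BlockLaw

namespace Summit.ValiantsHypothesis.ValiantsHypothesis.Theorems.LacunarySymmetroidMatrixDescartes.Pivot.RankOneCover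

/-! ## 1. The normal form -/

/-- **THE COVERING THEOREM, NORMAL FORM.**  For every exponent configuration in the interleaving chamber (B)
(`d₀ < d₁ < e < d₂ < d₃`, `d₀+d₂ < e+d₁`, `d₁+d₂ < 2e < d₀+d₃ < e+d₂`), all `t₀, t₁, t₂, t₃ > 0` (core letters `(1, tₖ)` in the
hyperbolic frame of the pivot) and all weights `wₖ > 0`, the eleven-nomial
`−X^{2e} − 2∑ₖ wₖtₖ X^{e+dₖ} + ∑_{k<l} wₖw_l (t_l − tₖ)² X^{dₖ+d_l}` has AT MOST EIGHT positive roots (Descartes' rule allows ten).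
Proof: the chamber splits at `4(e−d₁) = (e−d₀) + 2(d₂−e)`; on Region I one of the certificates (P), (P′) applies
(`RankOneCover.cover_P_or_Pprime` with `bound_P`, `bound_Pp`), on Region II one of (S), (S′), (T)
(`RankOneCover.cover_S_Sprime_T` with `bound_S`, `bound_Sp`, `bound_SpT`); the parallel loci are routed to (S) (`t₁ = t₃`, where (S)
reads `ρ_S ≤ 1`), to (P) with `D12 = 0` (`t₁ = t₂`) and to (P′) (`t₂ = t₃`, where its direction ratio is `1`). -/
theorem normalForm_chamberB_le_eight (e d₀ d₁ d₂ d₃ : ℕ) (h01 : d₀ < d₁) (h1e : d₁ < e) (he2 : e < d₂) (h23 : d₂ < d₃)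
    (hB1 : d₀ + d₂ < e + d₁) (hB2 : d₁ + d₂ < 2 * e) (hB3 : 2 * e < d₀ + d₃) (hB4 : d₀ + d₃ < e + d₂)
    (t₀ t₁ t₂ t₃ w₀ w₁ w₂ w₃ : ℝ) (ht₀ : 0 < t₀) (ht₁ : 0 < t₁) (ht₂ : 0 < t₂) (ht₃ : 0 < t₃)
    (hw₀ : 0 < w₀) (hw₁ : 0 < w₁) (hw₂ : 0 < w₂) (hw₃ : 0 < w₃) :
    ((∑ i : Fin 11, Polynomial.C ((![(-1 : ℝ), w₀ * (-(2 * t₀)), w₁ * (-(2 * t₁)), w₂ * (-(2 * t₂)), w₃ * (-(2 * t₃)), w₀ * w₁ * (t₁ - t₀) ^ 2, w₀ * w₂ * (t₂ - t₀) ^ 2, w₀ * w₃ * (t₃ - t₀) ^ 2, w₁ * w₂ * (t₂ - t₁) ^ 2, w₁ * w₃ * (t₃ - t₁) ^ 2, w₂ * w₃ * (t₃ - t₂) ^ 2] : Fin 11 → ℝ) i) * X ^ ((![2 * e, e + d₀, e + d₁, e + d₂, e + d₃, d₀ + d₁, d₀ + d₂, d₀ + d₃, d₁ + d₂, d₁ +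 d₃, d₂ + d₃] : Fin 11 → ℕ) i)).roots.toFinset.filter (fun t => 0 < t)).card ≤ 8 := by
  classical
  have hB5 : e + d₂ < d₁ + d₃ := by omega
  have rB1 : (d₀ : ℝ) + d₂ < e + d₁ := by exact_mod_cast hB1
  have rB2 : (d₁ : ℝ) + d₂ < 2 * e := by exact_mod_cast hB2
  have rB3 : 2 * (e : ℝ) < d₀ + d₃ := by exact_mod_cast hB3
  have rB4 : (d₀ : ℝ) + d₃ < e + d₂ := by exact_mod_cast hB4
  have hm : ∀ s : ℝ, 0 < s → -(2 * s) < 0 := fun s hs => by linarith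
  have _ht₂ := ht₂
  by_cases hR : 5 * e + d₀ ≤ 4 * d₁ + 2 * d₂
  · -- REGION I: certificates (P), (P′); parallel locus t₁ = t₃ → (S)
    have rR : 5 * (e : ℝ) + d₀ ≤ 4 * d₁ + 2 * d₂ := by exact_mod_cast hR
    by_cases h13 : t₁ = t₃
    · obtain ⟨hb, hpos, hnn⟩ := RankOneCover.bound_S_I (e : ℝ) d₀ d₁ d₂ d₃ rB2 rB3 rB4 rR
      obtain ⟨AS, hAS⟩ : ∃ x : ℝ, x = ((2 : ℝ) * e - d₀ - d₁) * ((e : ℝ) - d₁) * ((e : ℝ) + d₂ - d₀ - d₁) * ((d₂ : ℝ) - d₁) * ((d₂ : ℝ) - d₀) * ((d₃ : ℝ) - d₀) * ((d₂ : ℝ) + d₃ - d₀ - d₁) := ⟨_, rfl⟩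
      obtain ⟨BS, hBS⟩ : ∃ x : ℝ, x = ((d₁ : ℝ) - d₀) * ((e : ℝ) + d₁ - d₀ - d₂) * ((d₂ : ℝ) - e) * ((e : ℝ) - d₁) * ((d₂ : ℝ) - d₁) * ((d₃ : ℝ) - e) * ((d₂ : ℝ) + d₃ - e - d₁) := ⟨_, rfl⟩
      obtain ⟨CS, hCS⟩ : ∃ x : ℝ, x = ((d₃ : ℝ) - e) * ((d₃ : ℝ) - d₂) * ((d₀ : ℝ) + d₃ - d₁ - d₂) * ((d₀ : ℝ) + d₃ - 2 * e) * ((e : ℝ) + d₂ - d₀ - d₃) * ((d₁ : ℝ) - d₀) * ((d₂ : ℝ) - d₀) := ⟨_, rfl⟩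
      obtain ⟨DS, hDS⟩ : ∃ x : ℝ, x = ((e : ℝ) + d₃ - e - d₀) * ((d₃ : ℝ) - d₂ + e - d₀) * ((d₃ : ℝ) - d₂ + e - d₁) * ((d₃ : ℝ) - e) * ((d₃ : ℝ) - d₂) * ((e : ℝ) - d₁) * ((d₂ : ℝ) - e) := ⟨_, rfl⟩
      rw [← hAS, ← hBS, ← hCS, ← hDS] at hb
      rw [← hAS, ← hDS] at hpos
      rw [← hBS, ← hCS] at hnn
      have hle : BS * CS ≤ AS * DS := by linarith
      refine elevenNomial_chamberB_le_eight e d₀ d₁ d₂ d₃ h01 h1e he2 h23 hB1 (-1) (-(2 * t₀)) (-(2 * t₁)) (-(2 * t₂)) (-(2 * t₃)) w₀ w₁ w₂ w₃ ((t₁ - t₀) ^ 2) ((t₂ - t₀) ^ 2) ((t₃ - t₀) ^ 2) ((t₂ - t₁) ^ 2) ((t₃ - t₁) ^ 2) ((t₃ - t₂) ^ 2) hw₀ hw₁ hw₃ (hm _ ht₁) (hm _ ht₃) ?_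
      rw [← hAS, ← hBS, ← hCS, ← hDS, ← h13]
      linarith [mul_le_mul_of_nonneg_left hle (show (0:ℝ) ≤ 2 * t₁ * (t₁ - t₀) ^ 2 by positivity)]
    obtain ⟨hbP, hposP, hnnP⟩ := RankOneCover.bound_P (e : ℝ) d₀ d₁ d₂ d₃ rB2 rB3 rB4 rR
    obtain ⟨AP, hAP⟩ : ∃ x : ℝ, x = ((2 : ℝ) * e - d₀ - d₁) * ((e : ℝ) - d₁) * ((e : ℝ) - d₀) * ((e : ℝ) + d₂ - d₀ - d₁) * ((e : ℝ) + d₃ - d₀ - d₁) * ((d₂ : ℝ) - d₁) * ((d₃ : ℝ) - d₀) := ⟨_, rfl⟩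
    obtain ⟨BP, hBP⟩ : ∃ x : ℝ, x = ((d₁ : ℝ) + d₂ - e - d₀) * ((d₂ : ℝ) - e) * ((d₁ : ℝ) - d₀) * ((2 : ℝ) * e - d₁ - d₂) * ((e : ℝ) - d₁) * ((e : ℝ) + d₃ - d₁ - d₂) * ((d₃ : ℝ) - d₂) := ⟨_, rfl⟩
    obtain ⟨CP, hCP⟩ : ∃ x : ℝ, x = ((d₃ : ℝ) - e) * ((d₀ : ℝ) + d₃ - e - d₁) * ((d₃ : ℝ) - d₂) * ((d₀ : ℝ) + d₃ - 2 * e) * ((e : ℝ) + d₂ - d₀ - d₃) * ((d₁ : ℝ) - d₀) * ((e : ℝ) - d₀) := ⟨_, rfl⟩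
    obtain ⟨DP, hDP⟩ : ∃ x : ℝ, x = ((d₂ : ℝ) + d₃ - 2 * e) * ((d₂ : ℝ) + d₃ - e - d₀) * ((d₂ : ℝ) + d₃ - e - d₁) * ((d₃ : ℝ) - e) * ((d₂ : ℝ) - e) * ((d₃ : ℝ) - d₀) * ((d₂ : ℝ) - d₁) := ⟨_, rfl⟩
    rw [← hAP, ← hBP, ← hCP, ← hDP] at hbP
    rw [← hAP, ← hDP] at hposP
    rw [← hBP, ← hCP] at hnnP
    obtain ⟨hbQ, hposQ, hnnQ⟩ := RankOneCover.bound_Pp (e : ℝ) d₀ d₁ d₂ d₃ rB2 rB3 rB4 rR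
    obtain ⟨AQ, hAQ⟩ : ∃ x : ℝ, x = ((2 : ℝ) * e - d₀ - d₂) * ((d₂ : ℝ) - e) * ((e : ℝ) + d₁ - d₀ - d₂) * ((e : ℝ) - d₀) * ((e : ℝ) + d₃ - d₀ - d₂) * ((d₂ : ℝ) - d₁) * ((d₃ : ℝ) - d₀) := ⟨_, rfl⟩
    obtain ⟨BQ, hBQ⟩ : ∃ x : ℝ, x = ((2 : ℝ) * e - d₁ - d₂) * ((d₁ : ℝ) + d₂ - e - d₀) * ((d₂ : ℝ) - e) * ((e : ℝ) - d₁) * ((e : ℝ) + d₃ - d₁ - d₂) * ((d₂ : ℝ) - d₀) * ((d₃ : ℝ) - d₁) := ⟨_, rfl⟩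
    obtain ⟨CQ, hCQ⟩ : ∃ x : ℝ, x = ((d₀ : ℝ) + d₃ - 2 * e) * ((d₃ : ℝ) - e) * ((d₀ : ℝ) + d₃ - e - d₁) * ((e : ℝ) + d₂ - d₀ - d₃) * ((e : ℝ) - d₀) * ((d₃ : ℝ) - d₁) * ((d₂ : ℝ) - d₀) := ⟨_, rfl⟩
    obtain ⟨DQ, hDQ⟩ : ∃ x : ℝ, x = ((d₁ : ℝ) + d₃ - 2 * e) * ((d₁ : ℝ) + d₃ - e - d₀) * ((d₃ : ℝ) - e) * ((d₁ : ℝ) + d₃ - e - d₂) * ((e : ℝ) - d₁) * ((d₃ : ℝ) - d₀) * ((d₂ : ℝ) - d₁) := ⟨_, rfl⟩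
    rw [← hAQ, ← hBQ, ← hCQ, ← hDQ] at hbQ
    rw [← hAQ, ← hDQ] at hposQ
    rw [← hBQ, ← hCQ] at hnnQ
    -- the two ways out
    have useP : (BP * CP) * ((t₂ - t₁) ^ 2 * (t₃ - t₀) ^ 2) ≤ (AP * DP) * ((t₁ - t₀) ^ 2 * (t₃ - t₂) ^ 2) → t₂ ≠ t₃ →
        ((∑ i : Fin 11, Polynomial.C ((![(-1 : ℝ), w₀ * (-(2 * t₀)), w₁ * (-(2 * t₁)), w₂ * (-(2 * t₂)), w₃ * (-(2 * t₃)), w₀ * w₁ * (t₁ - t₀) ^ 2, w₀ * w₂ * (t₂ - t₀) ^ 2, w₀ * w₃ * (t₃ - t₀) ^ 2, w₁ * w₂ * (t₂ - t₁) ^ 2, w₁ * w₃ * (t₃ - t₁) ^ 2, w₂ * w₃ * (t₃ - t₂) ^ 2] : Fin 11 → ℝ) i) * X ^ ((![2 * e, e + d₀, e + d₁, e + d₂, e + d₃, d₀ + d₁, d₀ + d₂, d₀ + d₃, d₁ + d₂, d₁ + d₃, d₂ + d₃] : Fin 11 → ℕ) i)).roots.toFinset.filter (fun t => 0 < t)).card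 ≤ 8 := by
      intro hc h23'
      have hD23 : 0 < (t₃ - t₂) ^ 2 := by
        have : t₃ - t₂ ≠ 0 := sub_ne_zero.2 (Ne.symm h23')
        positivity
      refine elevenNomial_condP_le_eight_of_nonneg e d₀ d₁ d₂ d₃ h01 h1e he2 h23 hB2 (-1) (-(2 * t₀)) (-(2 * t₁)) (-(2 * t₂)) (-(2 * t₃)) w₀ w₁ w₂ w₃ ((t₁ - t₀) ^ 2) ((t₂ - t₀) ^ 2) ((t₃ - t₀) ^ 2) ((t₂ - t₁) ^ 2) ((t₃ - t₁) ^ 2) ((t₃ - t₂) ^ 2) hw₀ hw₁ hw₂ hw₃ (sq_nonneg _) hD23 ?_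
      rw [← hAP, ← hBP, ← hCP, ← hDP]
      linarith [hc]
    have useQ : (BQ * CQ) * ((t₂ - t₁) ^ 2 * (t₃ - t₀) ^ 2) ≤ (AQ * DQ) * ((t₂ - t₀) ^ 2 * (t₃ - t₁) ^ 2) → t₁ ≠ t₂ →
        ((∑ i : Fin 11, Polynomial.C ((![(-1 : ℝ), w₀ * (-(2 * t₀)), w₁ * (-(2 * t₁)), w₂ * (-(2 * t₂)), w₃ * (-(2 * t₃)), w₀ * w₁ * (t₁ - t₀) ^ 2, w₀ * w₂ * (t₂ - t₀) ^ 2, w₀ * w₃ * (t₃ - t₀) ^ 2, w₁ * w₂ * (t₂ - t₁) ^ 2, w₁ * w₃ * (t₃ - t₁) ^ 2, w₂ * w₃ * (t₃ - t₂) ^ 2] : Fin 11 → ℝ) i) * X ^ ((![2 * e, e + d₀, e + d₁, e + d₂, e + d₃, d₀ + d₁, d₀ + d₂, d₀ + d₃, d₁ + d₂, d₁ + d₃, d₂ + d₃] : Fin 11 → ℕ) i)).roots.toFinset.filter (fun t => 0 < t)).card ≤ 8 := by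
      intro hc h12
      have hD12 : 0 < (t₂ - t₁) ^ 2 := by
        have : t₂ - t₁ ≠ 0 := sub_ne_zero.2 (Ne.symm h12)
        positivity
      have hD13 : 0 < (t₃ - t₁) ^ 2 := by
        have : t₃ - t₁ ≠ 0 := sub_ne_zero.2 (Ne.symm h13)
        positivity
      refine elevenNomial_chamberB_Pprime_le_eight e d₀ d₁ d₂ d₃ h01 h1e he2 h23 hB2 hB3 hB5 (-1) (-(2 * t₀)) (-(2 * t₁)) (-(2 * t₂)) (-(2 * t₃)) w₀ w₁ w₂ w₃ ((t₁ - t₀) ^ 2) ((t₂ - t₀) ^ 2) ((t₃ - t₀) ^ 2) ((t₂ - t₁) ^ 2) ((t₃ - t₁) ^ 2) ((t₃ - t₂) ^ 2) hw₀ hw₁ hw₂ hw₃ hD12 hD13 ?_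
      rw [← hAQ, ← hBQ, ← hCQ, ← hDQ]
      linarith [hc]
    by_cases h12 : t₁ = t₂
    · -- letters 1 ∥ 2: (P) with D12 = 0, D23 > 0
      refine useP ?_ (fun h => h13 (h12.trans h))
      rw [← h12, sub_self]
      have e0 : (0 : ℝ) ^ 2 * (t₃ - t₀) ^ 2 = 0 := by ring
      rw [e0, mul_zero]
      positivity
    by_cases h23' : t₂ = t₃
    · -- letters 2 ∥ 3: (P′), whose direction ratio is then exactly 1
      refine useQ ?_ h12
      rw [← h23']
      have e1 : (t₂ - t₀) ^ 2 * (t₂ - t₁) ^ 2 = (t₂ - t₁) ^ 2 * (t₂ - t₀) ^ 2 := by ring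
      rw [e1]
      exact mul_le_mul_of_nonneg_right (by linarith) (by positivity)
    rcases RankOneCover.cover_P_or_Pprime t₀ t₁ t₂ t₃ (BP * CP) (AP * DP) (BQ * CQ) (AQ * DQ) hposP.le hposQ.le hbP hbQ
      with hc | hc
    · exact useP hc h23'
    · exact useQ hc h12
  · -- REGION II: certificates (S), (S′), (T); parallel locus t₁ = t₃ → (S)
    have rR : 4 * (d₁ : ℝ) + 2 * d₂ ≤ 5 * e + d₀ := by
      have : 4 * d₁ + 2 * d₂ ≤ 5 * e + d₀ := by omega
      exact_mod_cast this
    obtain ⟨hbS, hposS, hnnS⟩ := RankOneCover.bound_S (e : ℝ) d₀ d₁ d₂ d₃ rB1 rB3 rB4 rR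
    obtain ⟨AS, hAS⟩ : ∃ x : ℝ, x = ((2 : ℝ) * e - d₀ - d₁) * ((e : ℝ) - d₁) * ((e : ℝ) + d₂ - d₀ - d₁) * ((d₂ : ℝ) - d₁) * ((d₂ : ℝ) - d₀) * ((d₃ : ℝ) - d₀) * ((d₂ : ℝ) + d₃ - d₀ - d₁) := ⟨_, rfl⟩
    obtain ⟨BS, hBS⟩ : ∃ x : ℝ, x = ((d₁ : ℝ) - d₀) * ((e : ℝ) + d₁ - d₀ - d₂) * ((d₂ : ℝ) - e) * ((e : ℝ) - d₁) * ((d₂ : ℝ) - d₁) * ((d₃ : ℝ) - e) * ((d₂ : ℝ) + d₃ - e - d₁) := ⟨_, rfl⟩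
    obtain ⟨CS, hCS⟩ : ∃ x : ℝ, x = ((d₃ : ℝ) - e) * ((d₃ : ℝ) - d₂) * ((d₀ : ℝ) + d₃ - d₁ - d₂) * ((d₀ : ℝ) + d₃ - 2 * e) * ((e : ℝ) + d₂ - d₀ - d₃) * ((d₁ : ℝ) - d₀) * ((d₂ : ℝ) - d₀) := ⟨_, rfl⟩
    obtain ⟨DS, hDS⟩ : ∃ x : ℝ, x = ((e : ℝ) + d₃ - e - d₀) * ((d₃ : ℝ) - d₂ + e - d₀) * ((d₃ : ℝ) - d₂ + e - d₁) * ((d₃ : ℝ) - e) * ((d₃ : ℝ) - d₂) * ((e : ℝ) - d₁) * ((d₂ : ℝ) - e) := ⟨_, rfl⟩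
    rw [← hAS, ← hBS, ← hCS, ← hDS] at hbS
    rw [← hAS, ← hDS] at hposS
    rw [← hBS, ← hCS] at hnnS
    by_cases h13 : t₁ = t₃
    · have hle : BS * CS ≤ AS * DS := by linarith
      refine elevenNomial_chamberB_le_eight e d₀ d₁ d₂ d₃ h01 h1e he2 h23 hB1 (-1) (-(2 * t₀)) (-(2 * t₁)) (-(2 * t₂)) (-(2 * t₃)) w₀ w₁ w₂ w₃ ((t₁ - t₀) ^ 2) ((t₂ - t₀) ^ 2) ((t₃ - t₀) ^ 2) ((t₂ - t₁) ^ 2) ((t₃ - t₁) ^ 2) ((t₃ - t₂) ^ 2) hw₀ hw₁ hw₃ (hm _ ht₁) (hm _ ht₃) ?_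
      rw [← hAS, ← hBS, ← hCS, ← hDS, ← h13]
      linarith [mul_le_mul_of_nonneg_left hle (show (0:ℝ) ≤ 2 * t₁ * (t₁ - t₀) ^ 2 by positivity)]
    obtain ⟨hbU, hposU, hnnU⟩ := RankOneCover.bound_Sp (e : ℝ) d₀ d₁ d₂ d₃ rB1 rB3 rB4 rR
    obtain ⟨AU, hAU⟩ : ∃ x : ℝ, x = ((e : ℝ) - d₀) * ((d₂ : ℝ) - d₀) * ((d₃ : ℝ) - d₀) * ((e : ℝ) - d₁) * ((d₂ : ℝ) - e) * ((d₁ : ℝ) + d₂ - e - d₀) * ((d₂ : ℝ) + d₃ - e - d₀) := ⟨_, rfl⟩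
    obtain ⟨BU, hBU⟩ : ∃ x : ℝ, x = ((e : ℝ) - d₁) * ((d₂ : ℝ) - d₁) * ((d₃ : ℝ) - d₁) * ((e : ℝ) - d₀) * ((e : ℝ) + d₁ - d₀ - d₂) * ((d₂ : ℝ) - e) * ((d₂ : ℝ) + d₃ - e - d₁) := ⟨_, rfl⟩
    obtain ⟨CU, hCU⟩ : ∃ x : ℝ, x = ((d₀ : ℝ) + d₃ - 2 * e) * ((e : ℝ) + d₂ - d₀ - d₃) * ((e : ℝ) - d₀) * ((d₃ : ℝ) - d₁) * ((d₃ : ℝ) - d₂) * ((d₀ : ℝ) + d₃ - d₁ - d₂) * ((d₂ : ℝ) - d₀) := ⟨_, rfl⟩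
    obtain ⟨DU, hDU⟩ : ∃ x : ℝ, x = ((d₁ : ℝ) + d₃ - 2 * e) * ((d₁ : ℝ) + d₃ - e - d₂) * ((e : ℝ) - d₁) * ((d₃ : ℝ) - d₀) * ((d₁ : ℝ) + d₃ - d₀ - d₂) * ((d₃ : ℝ) - d₂) * ((d₂ : ℝ) - d₁) := ⟨_, rfl⟩
    rw [← hAU, ← hBU, ← hCU, ← hDU] at hbU
    rw [← hAU, ← hDU] at hposU
    rw [← hBU, ← hCU] at hnnU
    obtain ⟨hbV, hposV, hnnV⟩ := RankOneCover.bound_SpT (e : ℝ) d₀ d₁ d₂ d₃ rB1 rB3 rB4 rR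
    rw [← hAU, ← hBU, ← hCU, ← hDU] at hbV
    obtain ⟨AV, hAV⟩ : ∃ x : ℝ, x = ((e : ℝ) + d₂ - d₀ - d₁) * ((e : ℝ) + d₃ - d₀ - d₁) * ((d₂ : ℝ) - d₁) * ((d₃ : ℝ) - d₁) * ((d₂ : ℝ) - d₀) * ((d₃ : ℝ) - d₀) * ((d₂ : ℝ) + d₃ - d₀ - d₁) := ⟨_, rfl⟩
    obtain ⟨BV, hBV⟩ : ∃ x : ℝ, x = ((d₂ : ℝ) - d₀) * ((d₃ : ℝ) - d₀) * ((d₂ : ℝ) - e) * ((d₃ : ℝ) - e) * ((d₁ : ℝ) + d₂ - e - d₀) * ((d₁ : ℝ) + d₃ - e - d₀) * ((d₂ : ℝ) + d₃ - e - d₀) := ⟨_, rfl⟩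
    obtain ⟨CV, hCV⟩ : ∃ x : ℝ, x = ((e : ℝ) + d₁ - d₀ - d₂) * ((d₂ : ℝ) - d₁) * ((d₃ : ℝ) - d₁) * ((d₀ : ℝ) + d₃ - e - d₁) * ((d₂ : ℝ) - e) * ((d₃ : ℝ) - e) * ((d₂ : ℝ) + d₃ - e - d₁) := ⟨_, rfl⟩
    obtain ⟨DV, hDV⟩ : ∃ x : ℝ, x = ((2 : ℝ) * e - d₀ - d₂) * ((2 : ℝ) * e - d₁ - d₂) * ((d₂ : ℝ) - e) * ((d₃ : ℝ) - e) * ((d₀ : ℝ) + d₃ - 2 * e) * ((d₁ : ℝ) + d₃ - 2 * e) * ((d₂ : ℝ) + d₃ - 2 * e) := ⟨_, rfl⟩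
    rw [← hAV, ← hBV, ← hCV, ← hDV] at hbV
    rw [← hAV, ← hDV] at hposV
    rw [← hBV, ← hCV] at hnnV
    rcases RankOneCover.cover_S_Sprime_T t₀ t₁ t₃ (BS * CS) (AS * DS) (BU * CU) (AU * DU) (BV * CV) (AV * DV) ht₀ ht₁ ht₃
        hposS.le hposU hposV hnnV hbS (by linarith) (by linarith) with hc | hc | hc
    · refine elevenNomial_chamberB_le_eight e d₀ d₁ d₂ d₃ h01 h1e he2 h23 hB1 (-1) (-(2 * t₀)) (-(2 * t₁)) (-(2 * t₂)) (-(2 * t₃)) w₀ w₁ w₂ w₃ ((t₁ - t₀) ^ 2) ((t₂ - t₀) ^ 2) ((t₃ - t₀) ^ 2) ((t₂ - t₁) ^ 2) ((t₃ - t₁) ^ 2) ((t₃ - t₂) ^ 2) hw₀ hw₁ hw₃ (hm _ ht₁) (hm _ ht₃) ?_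
      rw [← hAS, ← hBS, ← hCS, ← hDS]
      linarith [hc]
    · have hD13 : 0 < (t₃ - t₁) ^ 2 := by
        have : t₃ - t₁ ≠ 0 := sub_ne_zero.2 (Ne.symm h13)
        positivity
      refine elevenNomial_condSprime_le_eight e d₀ d₁ d₂ d₃ h01 h1e he2 h23 hB1 hB5 (-1) (-(2 * t₀)) (-(2 * t₁)) (-(2 * t₂)) (-(2 * t₃)) w₀ w₁ w₂ w₃ ((t₁ - t₀) ^ 2) ((t₂ - t₀) ^ 2) ((t₃ - t₀) ^ 2) ((t₂ - t₁) ^ 2) ((t₃ - t₁) ^ 2) ((t₃ - t₂) ^ 2) hw₀ hw₁ hw₃ (hm _ ht₁) hD13 ?_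
      rw [← hAU, ← hBU, ← hCU, ← hDU]
      linarith [hc]
    · refine elevenNomial_condT_le_eight e d₀ d₁ d₂ d₃ h01 h1e he2 h23 hB1 hB2 hB3 (-1) (-(2 * t₀)) (-(2 * t₁)) (-(2 * t₂)) (-(2 * t₃)) w₀ w₁ w₂ w₃ ((t₁ - t₀) ^ 2) ((t₂ - t₀) ^ 2) ((t₃ - t₀) ^ 2) ((t₂ - t₁) ^ 2) ((t₃ - t₁) ^ 2) ((t₃ - t₂) ^ 2) hw₀ hw₁ (hm _ ht₀) (by norm_num) ?_
      rw [← hAV, ← hBV, ← hCV, ← hDV]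
      linarith [hc]

/-! ## 2. The matrix form: every symmetric pivot, every four rank-one letters -/

/-- **Isotropic frame of an indefinite symmetric `2 × 2` matrix.**  If `J` is symmetric with `det J < 0`, the quadratic form
`v ↦ vᵀ adj(J) v = J₀₀v₁² + J₁₁v₀² − 2J₀₁v₀v₁` is `−2 ℓ₁(v) ℓ₂(v)` for two real linear forms with `det[ℓ₁; ℓ₂]² = −det J`
(the two isotropic lines of `J`). [folklore] -/
theorem exists_isotropic_frame (J : Matrix (Fin 2) (Fin 2) ℝ) (hJ : J 0 1 = J 1 0) (hdet : J.det < 0) :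
    ∃ p q r s : ℝ, (p * s - q * r) ^ 2 = -J.det ∧
      ∀ v : Fin 2 → ℝ, J 0 0 * v 1 ^ 2 + J 1 1 * v 0 ^ 2 - (J 0 1 + J 1 0) * (v 0 * v 1)
        = -2 * ((p * v 0 + q * v 1) * (r * v 0 + s * v 1)) := by
  have hdet' : J.det = J 0 0 * J 1 1 - J 1 0 * J 1 0 := by rw [Matrix.det_fin_two, hJ]
  have hpos : 0 < J 1 0 ^ 2 - J 0 0 * J 1 1 := by nlinarith
  obtain ⟨δ, hδ⟩ : ∃ x : ℝ, x = Real.sqrt (J 1 0 ^ 2 - J 0 0 * J 1 1) := ⟨_, rfl⟩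
  have hδ2 : δ ^ 2 = J 1 0 ^ 2 - J 0 0 * J 1 1 := by rw [hδ]; exact Real.sq_sqrt hpos.le
  by_cases h11 : J 1 1 = 0
  · refine ⟨0, 1, J 1 0, -(J 0 0) / 2, ?_, fun v => ?_⟩
    · rw [hdet', h11]; ring
    · rw [hJ, h11]; ring
  · refine ⟨-(J 1 1) / 2, (J 1 0 + δ) / 2, 1, -((J 1 0 - δ) / J 1 1), ?_, fun v => ?_⟩
    · have e : -(J 1 1) / 2 * -((J 1 0 - δ) / J 1 1) - (J 1 0 + δ) / 2 * 1 = -δ := by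
        field_simp; ring
      rw [e, neg_sq, hδ2, hdet']; ring
    · have e : -2 * ((-(J 1 1) / 2 * v 0 + (J 1 0 + δ) / 2 * v 1) * (1 * v 0 + -((J 1 0 - δ) / J 1 1) * v 1))
          = J 1 1 * v 0 ^ 2 - 2 * J 1 0 * (v 0 * v 1) + ((J 1 0 ^ 2 - δ ^ 2) / J 1 1) * v 1 ^ 2 := by
        field_simp; ring
      rw [e, hδ2, hJ]
      field_simp
      ring

/-- Non-negativity of a coefficient of the eleven-nomial from entrywise information: the six pair coefficients are non-negative and
every pivot-type position whose degree equals `m₀` carries a non-negative coefficient. -/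
theorem coeff_elevenNomial_nonneg (e d₀ d₁ d₂ d₃ : ℕ) (cv : Fin 11 → ℝ) (hpos : ∀ i : Fin 11, 5 ≤ (i : ℕ) → 0 ≤ cv i) (m₀ : ℕ)
    (hpiv : ∀ i : Fin 11, (i : ℕ) < 5 →
      m₀ = (![2 * e, e + d₀, e + d₁, e + d₂, e + d₃, d₀ + d₁, d₀ + d₂, d₀ + d₃, d₁ + d₂, d₁ + d₃, d₂ + d₃] : Fin 11 → ℕ) i → 0 ≤ cv i) :
    0 ≤ (∑ i : Fin 11, Polynomial.C (cv i) * X ^ ((![2 * e, e + d₀, e + d₁, e + d₂, e + d₃, d₀ + d₁, d₀ + d₂, d₀ + d₃, d₁ + d₂, d₁ + d₃, d₂ + d₃] : Fin 11 → ℕ) i)).coeff m₀ := by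
  rw [RankOneReduction.coeff_elevenNomial]
  refine Finset.sum_nonneg fun i _ => ?_
  split_ifs with h
  · by_cases hi : 5 ≤ (i : ℕ)
    · exact hpos i hi
    · exact hpiv i (by omega) h
  · exact le_rfl

/-- **RANK-ONE `(2,4)₁` IN CHAMBER (B): `Z₊ ≤ 8`, UNCONDITIONALLY** (matrix form).  `J` any real symmetric `2 × 2` matrix, letters
`wₖ vₖvₖᵀ` with `wₖ > 0` and arbitrary `vₖ ∈ ℝ²`, exponents `d₀ < d₁ < e < d₂ < d₃` with `d₀ + d₂ < e + d₁`,
`d₁ + d₂ < 2e < d₀ + d₃ < e + d₂`: the determinant of `X^e J + ∑ₖ wₖ X^{dₖ} vₖvₖᵀ` has at most eight distinct positive roots.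
[this file] -/
theorem rankOne_chamberB_posRoots_le_eight (e d₀ d₁ d₂ d₃ : ℕ) (h01 : d₀ < d₁) (h1e : d₁ < e) (he2 : e < d₂) (h23 : d₂ < d₃)
    (hB1 : d₀ + d₂ < e + d₁) (hB2 : d₁ + d₂ < 2 * e) (hB3 : 2 * e < d₀ + d₃) (hB4 : d₀ + d₃ < e + d₂)
    (J : Matrix (Fin 2) (Fin 2) ℝ) (hJ : J 0 1 = J 1 0) (v₀ v₁ v₂ v₃ : Fin 2 → ℝ) (w₀ w₁ w₂ w₃ : ℝ)
    (hw₀ : 0 < w₀) (hw₁ : 0 < w₁) (hw₂ : 0 < w₂) (hw₃ : 0 < w₃) :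
    ((Matrix.det (((X : ℝ[X]) ^ e) • J.map Polynomial.C
        + (Polynomial.C w₀ * X ^ d₀) • (vecMulVec v₀ v₀).map Polynomial.C
        + (Polynomial.C w₁ * X ^ d₁) • (vecMulVec v₁ v₁).map Polynomial.C
        + (Polynomial.C w₂ * X ^ d₂) • (vecMulVec v₂ v₂).map Polynomial.C
        + (Polynomial.C w₃ * X ^ d₃) • (vecMulVec v₃ v₃).map Polynomial.C)).roots.toFinset.filter (fun t => 0 < t)).card
      ≤ 8 := by
  classical
  rw [det_rankOne_four_sum]
  -- the six pair coefficients are non-negative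
  have hpair : ∀ i : Fin 11, 5 ≤ (i : ℕ) →
      0 ≤ (![J.det, w₀ * (J 0 0 * v₀ 1 ^ 2 + J 1 1 * v₀ 0 ^ 2 - (J 0 1 + J 1 0) * (v₀ 0 * v₀ 1)), w₁ * (J 0 0 * v₁ 1 ^ 2 + J 1 1 * v₁ 0 ^ 2 - (J 0 1 + J 1 0) * (v₁ 0 * v₁ 1)), w₂ * (J 0 0 * v₂ 1 ^ 2 + J 1 1 * v₂ 0 ^ 2 - (J 0 1 + J 1 0) * (v₂ 0 * v₂ 1)), w₃ * (J 0 0 * v₃ 1 ^ 2 + J 1 1 * v₃ 0 ^ 2 - (J 0 1 + J 1 0) * (v₃ 0 * v₃ 1)), w₀ * w₁ * ((v₀ 0 * v₁ 1 - v₀ 1 * v₁ 0) ^ 2), w₀ * w₂ * ((v₀ 0 * v₂ 1 - v₀ 1 * v₂ 0) ^ 2), w₀ * w₃ * ((v₀ 0 * v₃ 1 - v₀ 1 * v₃ 0) ^ 2), w₁ * w₂ * ((v₁ 0 * v₂ 1 - v₁ 1 * v₂ 0) ^ 2), w₁ * w₃ * ((v₁ 0 * v₃ 1 - v₁ 1 *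 v₃ 0) ^ 2), w₂ * w₃ * ((v₂ 0 * v₃ 1 - v₂ 1 * v₃ 0) ^ 2)] : Fin 11 → ℝ) i := by
    intro i hi
    fin_cases i <;>
      first
        | (simp only [Fin.isValue, Fin.reduceFinMk, Matrix.cons_val]; positivity)
        | (norm_num at hi)
  -- (0a) a semidefinite or degenerate pivot: the coefficient at `2e` is `det J ≥ 0`
  by_cases hdet : 0 ≤ J.det
  · refine RankOneReduction.elevenNomial_le_eight_of_coeff_nonneg e d₀ d₁ d₂ d₃ _ hpair (2 * e) (Or.inl rfl)
      (coeff_elevenNomial_nonneg e d₀ d₁ d₂ d₃ _ hpair (2 * e) fun i _ h => ?_)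
    fin_cases i <;> simp only [Fin.isValue, Fin.reduceFinMk, Matrix.cons_val] at h ⊢ <;>
      first | exact hdet | omega
  push Not at hdet
  -- (0b) a non-core letter: the coefficient at `e + dₖ` is `wₖ m(J,vₖ) ≥ 0`
  by_cases hm₀ : 0 ≤ J 0 0 * v₀ 1 ^ 2 + J 1 1 * v₀ 0 ^ 2 - (J 0 1 + J 1 0) * (v₀ 0 * v₀ 1)
  · refine RankOneReduction.elevenNomial_le_eight_of_coeff_nonneg e d₀ d₁ d₂ d₃ _ hpair (e + d₀) (Or.inr (Or.inl rfl))
      (coeff_elevenNomial_nonneg e d₀ d₁ d₂ d₃ _ hpair (e + d₀) fun i _ h => ?_)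
    fin_cases i <;> simp only [Fin.isValue, Fin.reduceFinMk, Matrix.cons_val] at h ⊢ <;>
      first | exact mul_nonneg hw₀.le hm₀ | omega
  by_cases hm₁ : 0 ≤ J 0 0 * v₁ 1 ^ 2 + J 1 1 * v₁ 0 ^ 2 - (J 0 1 + J 1 0) * (v₁ 0 * v₁ 1)
  · refine RankOneReduction.elevenNomial_le_eight_of_coeff_nonneg e d₀ d₁ d₂ d₃ _ hpair (e + d₁) (Or.inr (Or.inr (Or.inl rfl)))
      (coeff_elevenNomial_nonneg e d₀ d₁ d₂ d₃ _ hpair (e + d₁) fun i _ h => ?_)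
    fin_cases i <;> simp only [Fin.isValue, Fin.reduceFinMk, Matrix.cons_val] at h ⊢ <;>
      first | exact mul_nonneg hw₁.le hm₁ | omega
  by_cases hm₂ : 0 ≤ J 0 0 * v₂ 1 ^ 2 + J 1 1 * v₂ 0 ^ 2 - (J 0 1 + J 1 0) * (v₂ 0 * v₂ 1)
  · refine RankOneReduction.elevenNomial_le_eight_of_coeff_nonneg e d₀ d₁ d₂ d₃ _ hpair (e + d₂)
      (Or.inr (Or.inr (Or.inr (Or.inl rfl))))
      (coeff_elevenNomial_nonneg e d₀ d₁ d₂ d₃ _ hpair (e + d₂) fun i _ h => ?_)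
    fin_cases i <;> simp only [Fin.isValue, Fin.reduceFinMk, Matrix.cons_val] at h ⊢ <;>
      first | exact mul_nonneg hw₂.le hm₂ | omega
  by_cases hm₃ : 0 ≤ J 0 0 * v₃ 1 ^ 2 + J 1 1 * v₃ 0 ^ 2 - (J 0 1 + J 1 0) * (v₃ 0 * v₃ 1)
  · refine RankOneReduction.elevenNomial_le_eight_of_coeff_nonneg e d₀ d₁ d₂ d₃ _ hpair (e + d₃)
      (Or.inr (Or.inr (Or.inr (Or.inr rfl))))
      (coeff_elevenNomial_nonneg e d₀ d₁ d₂ d₃ _ hpair (e + d₃) fun i _ h => ?_)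
    fin_cases i <;> simp only [Fin.isValue, Fin.reduceFinMk, Matrix.cons_val] at h ⊢ <;>
      first | exact mul_nonneg hw₃.le hm₃ | omega
  push Not at hm₀ hm₁ hm₂ hm₃
  -- (1) the hard cell: isotropic frame, normal form
  obtain ⟨p, q, r, s, hc, hfac⟩ := exists_isotropic_frame J hJ hdet
  obtain ⟨c2, hc2⟩ : ∃ x : ℝ, x = -J.det := ⟨_, rfl⟩
  have hc2pos : 0 < c2 := by rw [hc2]; linarith
  have hΔ : ∀ v w : Fin 2 → ℝ, (p * v 0 + q * v 1) * (r * w 0 + s * w 1) - (p * w 0 + q * w 1) * (r * v 0 + s * v 1)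
      = (p * s - q * r) * (v 0 * w 1 - v 1 * w 0) := fun v w => by ring
  -- frame coordinates of the four letters
  obtain ⟨α₀, hα₀⟩ : ∃ x : ℝ, x = p * v₀ 0 + q * v₀ 1 := ⟨_, rfl⟩
  obtain ⟨β₀, hβ₀⟩ : ∃ x : ℝ, x = r * v₀ 0 + s * v₀ 1 := ⟨_, rfl⟩
  obtain ⟨α₁, hα₁⟩ : ∃ x : ℝ, x = p * v₁ 0 + q * v₁ 1 := ⟨_, rfl⟩
  obtain ⟨β₁, hβ₁⟩ : ∃ x : ℝ, x = r * v₁ 0 + s * v₁ 1 := ⟨_, rfl⟩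
  obtain ⟨α₂, hα₂⟩ : ∃ x : ℝ, x = p * v₂ 0 + q * v₂ 1 := ⟨_, rfl⟩
  obtain ⟨β₂, hβ₂⟩ : ∃ x : ℝ, x = r * v₂ 0 + s * v₂ 1 := ⟨_, rfl⟩
  obtain ⟨α₃, hα₃⟩ : ∃ x : ℝ, x = p * v₃ 0 + q * v₃ 1 := ⟨_, rfl⟩
  obtain ⟨β₃, hβ₃⟩ : ∃ x : ℝ, x = r * v₃ 0 + s * v₃ 1 := ⟨_, rfl⟩
  have f₀ := hfac v₀; have f₁ := hfac v₁; have f₂ := hfac v₂; have f₃ := hfac v₃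
  rw [← hα₀, ← hβ₀] at f₀; rw [← hα₁, ← hβ₁] at f₁; rw [← hα₂, ← hβ₂] at f₂; rw [← hα₃, ← hβ₃] at f₃
  have g₀ : 0 < α₀ * β₀ := by linarith
  have g₁ : 0 < α₁ * β₁ := by linarith
  have g₂ : 0 < α₂ * β₂ := by linarith
  have g₃ : 0 < α₃ * β₃ := by linarith
  have a₀ : α₀ ≠ 0 := fun h => by rw [h, zero_mul] at g₀; exact lt_irrefl _ g₀
  have a₁ : α₁ ≠ 0 := fun h => by rw [h, zero_mul] at g₁; exact lt_irrefl _ g₁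
  have a₂ : α₂ ≠ 0 := fun h => by rw [h, zero_mul] at g₂; exact lt_irrefl _ g₂
  have a₃ : α₃ ≠ 0 := fun h => by rw [h, zero_mul] at g₃; exact lt_irrefl _ g₃
  have tpos : ∀ α β : ℝ, 0 < α * β → α ≠ 0 → 0 < β / α := fun α β h hα => by
    have e1 : β / α = (α * β) / α ^ 2 := by field_simp
    rw [e1]; exact div_pos h (by positivity)
  -- Plücker products in the frame
  have q₀₁ := hΔ v₀ v₁; have q₀₂ := hΔ v₀ v₂; have q₀₃ := hΔ v₀ v₃
  have q₁₂ := hΔ v₁ v₂; have q₁₃ := hΔ v₁ v₃; have q₂₃ := hΔ v₂ v₃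
  rw [← hα₀, ← hβ₀, ← hα₁, ← hβ₁] at q₀₁; rw [← hα₀, ← hβ₀, ← hα₂, ← hβ₂] at q₀₂
  rw [← hα₀, ← hβ₀, ← hα₃, ← hβ₃] at q₀₃; rw [← hα₁, ← hβ₁, ← hα₂, ← hβ₂] at q₁₂
  rw [← hα₁, ← hβ₁, ← hα₃, ← hβ₃] at q₁₃; rw [← hα₂, ← hβ₂, ← hα₃, ← hβ₃] at q₂₃
  rw [← hc2] at hc
  -- the normal-form data
  have key := normalForm_chamberB_le_eight e d₀ d₁ d₂ d₃ h01 h1e he2 h23 hB1 hB2 hB3 hB4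
    (β₀ / α₀) (β₁ / α₁) (β₂ / α₂) (β₃ / α₃) (w₀ * α₀ ^ 2 / c2) (w₁ * α₁ ^ 2 / c2) (w₂ * α₂ ^ 2 / c2) (w₃ * α₃ ^ 2 / c2)
    (tpos _ _ g₀ a₀) (tpos _ _ g₁ a₁) (tpos _ _ g₂ a₂) (tpos _ _ g₃ a₃)
    (by positivity) (by positivity) (by positivity) (by positivity)
  -- the matrix eleven-nomial is `C c2` times the normal form
  have hscale : (∑ i : Fin 11, Polynomial.C ((![J.det, w₀ * (J 0 0 * v₀ 1 ^ 2 + J 1 1 * v₀ 0 ^ 2 - (J 0 1 + J 1 0) * (v₀ 0 * v₀ 1)), w₁ * (J 0 0 * v₁ 1 ^ 2 + J 1 1 * v₁ 0 ^ 2 - (J 0 1 + J 1 0) * (v₁ 0 * v₁ 1)), w₂ * (J 0 0 * v₂ 1 ^ 2 + J 1 1 * v₂ 0 ^ 2 - (J 0 1 + J 1 0) * (v₂ 0 * v₂ 1)), w₃ * (J 0 0 * v₃ 1 ^ 2 + J 1 1 * v₃ 0 ^ 2 - (J 0 1 + J 1 0) * (v₃ 0 * v₃ 1)), w₀ * w₁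 * ((v₀ 0 * v₁ 1 - v₀ 1 * v₁ 0) ^ 2), w₀ * w₂ * ((v₀ 0 * v₂ 1 - v₀ 1 * v₂ 0) ^ 2), w₀ * w₃ * ((v₀ 0 * v₃ 1 - v₀ 1 * v₃ 0) ^ 2), w₁ * w₂ * ((v₁ 0 * v₂ 1 - v₁ 1 * v₂ 0) ^ 2), w₁ * w₃ * ((v₁ 0 * v₃ 1 - v₁ 1 * v₃ 0) ^ 2), w₂ * w₃ * ((v₂ 0 * v₃ 1 - v₂ 1 * v₃ 0) ^ 2)] : Fin 11 → ℝ) i)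
        * X ^ ((![2 * e, e + d₀, e + d₁, e + d₂, e + d₃, d₀ + d₁, d₀ + d₂, d₀ + d₃, d₁ + d₂, d₁ + d₃, d₂ + d₃] : Fin 11 → ℕ) i))
      = Polynomial.C c2 * (∑ i : Fin 11, Polynomial.C ((![(-1 : ℝ), (w₀ * α₀ ^ 2 / c2) * (-(2 * (β₀ / α₀))), (w₁ * α₁ ^ 2 / c2) * (-(2 * (β₁ / α₁))), (w₂ * α₂ ^ 2 / c2) * (-(2 * (β₂ / α₂))), (w₃ * α₃ ^ 2 / c2) * (-(2 * (β₃ / α₃))), (w₀ * α₀ ^ 2 / c2) * (w₁ * α₁ ^ 2 / c2) * ((β₁ / α₁) - (β₀ / α₀)) ^ 2, (w₀ * α₀ ^ 2 / c2) * (w₂ * α₂ ^ 2 / c2) * ((β₂ / α₂) - (β₀ / α₀)) ^ 2, (w₀ * α₀ ^ 2 / c2) * (w₃ * α₃ ^ 2 / c2) * ((β₃ / α₃) - (β₀ / α₀)) ^ 2, (w₁ * α₁ ^ 2 / c2) * (w₂ * α₂ ^ 2 / c2) * ((β₂ / α₂) - (β₁ / α₁)) ^ 2, (w₁ * α₁ ^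 2 / c2) * (w₃ * α₃ ^ 2 / c2) * ((β₃ / α₃) - (β₁ / α₁)) ^ 2, (w₂ * α₂ ^ 2 / c2) * (w₃ * α₃ ^ 2 / c2) * ((β₃ / α₃) - (β₂ / α₂)) ^ 2] : Fin 11 → ℝ) i)
        * X ^ ((![2 * e, e + d₀, e + d₁, e + d₂, e + d₃, d₀ + d₁, d₀ + d₂, d₀ + d₃, d₁ + d₂, d₁ + d₃, d₂ + d₃] : Fin 11 → ℕ) i)) := by
    have hc2ne : c2 ≠ 0 := hc2pos.ne'
    -- squared Plücker products in the frame
    have s₀₁ : (α₀ * β₁ - α₁ * β₀) ^ 2 = c2 * (v₀ 0 * v₁ 1 - v₀ 1 * v₁ 0) ^ 2 := by rw [q₀₁, mul_pow, hc]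
    have s₀₂ : (α₀ * β₂ - α₂ * β₀) ^ 2 = c2 * (v₀ 0 * v₂ 1 - v₀ 1 * v₂ 0) ^ 2 := by rw [q₀₂, mul_pow, hc]
    have s₀₃ : (α₀ * β₃ - α₃ * β₀) ^ 2 = c2 * (v₀ 0 * v₃ 1 - v₀ 1 * v₃ 0) ^ 2 := by rw [q₀₃, mul_pow, hc]
    have s₁₂ : (α₁ * β₂ - α₂ * β₁) ^ 2 = c2 * (v₁ 0 * v₂ 1 - v₁ 1 * v₂ 0) ^ 2 := by rw [q₁₂, mul_pow, hc]
    have s₁₃ : (α₁ * β₃ - α₃ * β₁) ^ 2 = c2 * (v₁ 0 * v₃ 1 - v₁ 1 * v₃ 0) ^ 2 := by rw [q₁₃, mul_pow, hc]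
    have s₂₃ : (α₂ * β₃ - α₃ * β₂) ^ 2 = c2 * (v₂ 0 * v₃ 1 - v₂ 1 * v₃ 0) ^ 2 := by rw [q₂₃, mul_pow, hc]
    -- pair entries: c2 · ŵₖŵ_l (t_l − tₖ)² = wₖw_l (αₖβ_l − α_lβₖ)²/c2 = wₖw_l Δ²
    have pair : ∀ (wk wl αk βk αl βl Δ : ℝ), αk ≠ 0 → αl ≠ 0 → (αk * βl - αl * βk) ^ 2 = c2 * Δ ^ 2 →
        wk * wl * Δ ^ 2 = c2 * (wk * αk ^ 2 / c2 * (wl * αl ^ 2 / c2) * (βl / αl - βk / αk) ^ 2) := by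
      intro wk wl αk βk αl βl Δ hk hl hsq
      have e1 : c2 * (wk * αk ^ 2 / c2 * (wl * αl ^ 2 / c2) * (βl / αl - βk / αk) ^ 2)
          = wk * wl * (αk * βl - αl * βk) ^ 2 / c2 := by
        field_simp
      rw [e1, hsq]
      field_simp
    -- pivot-type entries: c2 · ŵₖ (−2tₖ) = −2 wₖ αₖβₖ
    have piv : ∀ (wk αk βk : ℝ), αk ≠ 0 →
        wk * (-2 * (αk * βk)) = c2 * (wk * αk ^ 2 / c2 * (-(2 * (βk / αk)))) := by
      intro wk αk βk hk
      field_simp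
    rw [Finset.mul_sum]
    refine Finset.sum_congr rfl fun i _ => ?_
    rw [show ∀ (a b : ℝ) (Y : ℝ[X]), Polynomial.C a * (Polynomial.C b * Y) = Polynomial.C (a * b) * Y from
      fun a b Y => by rw [Polynomial.C_mul, mul_assoc]]
    congr 2
    fin_cases i
    · simp only [Fin.zero_eta, Fin.isValue, Matrix.cons_val_zero]
      rw [hc2]; ring
    · simp only [Fin.mk_one, Fin.isValue, Matrix.cons_val_one, Matrix.cons_val_zero]
      rw [f₀]; exact piv w₀ α₀ β₀ a₀
    · simp only [Fin.reduceFinMk, Fin.isValue, Matrix.cons_val]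
      rw [f₁]; exact piv w₁ α₁ β₁ a₁
    · simp only [Fin.reduceFinMk, Fin.isValue, Matrix.cons_val]
      rw [f₂]; exact piv w₂ α₂ β₂ a₂
    · simp only [Fin.reduceFinMk, Fin.isValue, Matrix.cons_val]
      rw [f₃]; exact piv w₃ α₃ β₃ a₃
    · simp only [Fin.reduceFinMk, Fin.isValue, Matrix.cons_val]
      exact pair w₀ w₁ α₀ β₀ α₁ β₁ _ a₀ a₁ s₀₁
    · simp only [Fin.reduceFinMk, Fin.isValue, Matrix.cons_val]
      exact pair w₀ w₂ α₀ β₀ α₂ β₂ _ a₀ a₂ s₀₂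
    · simp only [Fin.reduceFinMk, Fin.isValue, Matrix.cons_val]
      exact pair w₀ w₃ α₀ β₀ α₃ β₃ _ a₀ a₃ s₀₃
    · simp only [Fin.reduceFinMk, Fin.isValue, Matrix.cons_val]
      exact pair w₁ w₂ α₁ β₁ α₂ β₂ _ a₁ a₂ s₁₂
    · simp only [Fin.reduceFinMk, Fin.isValue, Matrix.cons_val]
      exact pair w₁ w₃ α₁ β₁ α₃ β₃ _ a₁ a₃ s₁₃
    · simp only [Fin.reduceFinMk, Fin.isValue, Matrix.cons_val]
      exact pair w₂ w₃ α₂ β₂ α₃ β₃ _ a₂ a₃ s₂₃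
  rw [hscale, Polynomial.roots_C_mul _ hc2pos.ne']
  exact key

end Summit.ValiantsHypothesis.ValiantsHypothesis.Theorems.LacunarySymmetroidMatrixDescartes.Pivot.RankOneCover
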